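import Summits.BirchSwinnertonDyer.BirchSwinnertonDyer.Theses.SignedBaseChange
import HarnessLib

/-!
# `SignedBaseChange.PublishedSignedInputsGlue` holds (route SignedBaseChange, glue of the readiness split of the shared
support `PublishedSignedInputs`; item stmt-BirchSwinnertonDyer-20273)

`PublishedSignedInputsGlue : C1 → … → C10 → PublishedSignedInputs` where `C1, …, C10` are the ten `cite_only` conjuncts of
`PublishedSignedInputs` BY NAME, in conjunct order: the proof is the anonymous constructor (exactly as route
SignedLowerHalves' item 19292, `Theorems/…publishedSignedInputsOfParts_holds`). Statement PRINTED fully qualified.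
File with: `ledger propose --kind proof --target Summits/BirchSwinnertonDyer/BirchSwinnertonDyer/Theorems/SignedBaseChangePublishedSignedInputsGlue.lean
  --file <this> --workitem stmt-BirchSwinnertonDyer-20273`.
-/

set_option autoImplicit false

namespace Summit.BirchSwinnertonDyer.BirchSwinnertonDyer.Theorems.SignedBaseChangePublishedSignedInputsGlue

/-- The ten published inputs, given one by one, assemble to the conjunction `PublishedSignedInputs`. -/
theorem publishedSignedInputsGlue_holds :
    Summit.BirchSwinnertonDyer.BirchSwinnertonDyer.Theses.SignedBaseChange.PublishedSignedInputsGlue := by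
  intro h1 h2 h3 h4 h5 h6 h7 h8 h9 h10
  exact ⟨h1, h2, h3, h4, h5, h6, h7, h8, h9, h10⟩

end Summit.BirchSwinnertonDyer.BirchSwinnertonDyer.Theorems.SignedBaseChangePublishedSignedInputsGlue
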